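import Mathlib
import Literature.Barriers.ValiantsHypothesis.AlgebraicNaturalProofs
import Literature.Computability.AlgebraicComplexity.ArithCircuitProofs
import Summits.ValiantsHypothesis.ValiantsHypothesis.Theorems.BarrierLeverSuccinctHittingSetsForVPLowDegree
import Summits.ValiantsHypothesis.ValiantsHypothesis.Theorems.BarrierLeverSuccinctHittingSetsForVPStubFullSupport
import HarnessLib

/-!
# Crux `BarrierLever.SuccinctHittingSetsForVP` (stmt-ValiantsHypothesis-14610), line `registered` —
stub `stub_partitionRankMaximal`: THE PARTITION COEFFICIENT MATRIX IS MAXIMAL ON SMALL CIRCUITS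

**What is proved (unconditional; a worker-sized stub carved from the open heart, it does NOT close
the item).** In FSV's framework over `ℂ` (tree regime `d = n`, simple class
`SmallCircuits ℂ n b = {f : deg f ≤ n, L(f) ≤ n^b}`):

* `stub_partitionRankMaximal` : for `n ≥ 2`, `2h ≤ n`, `2k ≤ n` there is `f ∈ SmallCircuits ℂ n 2`
  whose coefficient matrix of the VARIABLE PARTITION `{x_0, …, x_{h-1}} ⊔ {x_h, …, x_{n-1}}`
  (Nisan 1991 / Raz 2009: rows = monomials `p` in the first `h` variables of degree `≤ k`,
  columns = monomials `q` in the remaining variables of degree `≤ n - k`, entry `coeff_{p+q} f`)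
  has LINEARLY INDEPENDENT ROWS (full row rank).

So no rank threshold of this partition / evaluation-dimension method is an equation for `VP` in
the regime `d = n`: the small circuit `f` already attains the maximum.

**Witness and proof.** `f = Σ_{d ≤ k} S^d` with the inner product `S = Σ_{i < h} x_i x_{i+h}`
(`2h ≤ n`). (a) `deg f ≤ 2k ≤ n`; Horner's form `f = 1 + S (1 + S (⋯))` and the size lemmas
`L(u + v), L(u v) ≤ L(u) + L(v) + 1`, `L(x_i) = L(1) = 0` give `L(f) ≤ k (2h + 2) ≤ n²`.
(b) Every monomial of `S^d` is BALANCED: of the form `x + shift x` with `supp x ⊆ [0, h)`, `|x| = d`,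
where `shift` translates exponents from `x_i` to `x_{i+h}` (induction on `d`, `support_mul`).
(c) The diagonal entry `coeff_{p + shift p} S^{|p|}` is a positive integer: over `ℕ`,
`coeff_{a+b}(A B) ≥ coeff_a A · coeff_b B`, peel one factor `x_i x_{i+h}` at a time; transfer to
`ℂ` along `MvPolynomial.map (Nat.castRingHom ℂ)`. (d) Independence: test a vanishing combination
`Σ_p a_p row_p = 0` at the column `q₀ = shift p₀` (support `⊆ [h, 2h)`, degree `|p₀| ≤ k ≤ n - k`):
`coeff_{p + shift p₀} f ≠ 0` forces `p + shift p₀` balanced, i.e. `p = p₀`, so `a_{p₀} = 0`.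
No new definitions: `S` enters the helper lemmas as a hypothesis `hS : S = Σ …`.
Axioms: `propext`, `Classical.choice`, `Quot.sound`.

References: [Nisan1991Noncommutative] (rank of the partial-derivative / partition matrix);
[Raz2009] §1 (coefficient matrix of a variable partition, full rank); [ForbesShpilkaVolk2018]
Question 6, Cor. 5 (the framework); [Burgisser2000] Def. 2.1, §2.1 (the complexity measure).
-/

-- layout Summits/ValiantsHypothesis/ValiantsHypothesis forces the duplicated namespace component
set_option linter.dupNamespace false

namespace Summit.ValiantsHypothesis.ValiantsHypothesis.Theorems.BarrierLever.SuccinctHittingSetsForVP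

open Literature.Barriers.ValiantsHypothesis Literature.Computability.AlgebraicComplexity MvPolynomial

namespace PartitionRankMaximal

section General

/-- Over `ℕ` a single term of the Cauchy product bounds the coefficient from below:
`coeff_a A · coeff_b B ≤ coeff_{a+b} (A B)`. [folklore] -/
theorem mul_coeff_le_coeff_mul {σ : Type*} (a b : σ →₀ ℕ) (A B : MvPolynomial σ ℕ) :
    coeff a A * coeff b B ≤ coeff (a + b) (A * B) := by
  classical
  rw [coeff_mul]
  exact Finset.single_le_sum (f := fun x : (σ →₀ ℕ) × (σ →₀ ℕ) => coeff x.1 A * coeff x.2 B)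
    (fun _ _ => Nat.zero_le _) (a := (a, b)) (Finset.HasAntidiagonal.mem_antidiagonal.mpr rfl)

/-- Horner bound: `L(Σ_{j ≤ d} S^j) ≤ d (L(S) + 2)`, from `Σ_{j ≤ d+1} S^j = S · (Σ_{j ≤ d} S^j) + 1`
and `L(u v), L(u + v) ≤ L(u) + L(v) + 1`, `L(1) = 0`. [cite: Burgisser2000, §2.1] -/
theorem complexity_geom_sum_le {n : ℕ} (S : MvPolynomial (Fin n) ℂ) :
    ∀ d : ℕ, complexity (∑ j ∈ Finset.range (d + 1), S ^ j) ≤ d * (complexity S + 2) := by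
  intro d
  induction d with
  | zero => simp [LowDegree.complexity_one]
  | succ d ih =>
    rw [geom_sum_succ]
    calc complexity (S * ∑ j ∈ Finset.range (d + 1), S ^ j + 1)
        ≤ complexity (S * ∑ j ∈ Finset.range (d + 1), S ^ j) +
            complexity (1 : MvPolynomial (Fin n) ℂ) + 1 := complexity_add_le_holds _ _
      _ ≤ complexity S + complexity (∑ j ∈ Finset.range (d + 1), S ^ j) + 1 + 0 + 1 := by
          rw [LowDegree.complexity_one]
          exact Nat.add_le_add_right (Nat.add_le_add_right (complexity_mul_le_holds _ _) _) _
      _ ≤ complexity S + d * (complexity S + 2) + 2 := by omega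
      _ = (d + 1) * (complexity S + 2) := by ring

end General

section Shift

variable {n : ℕ} {c : Fin n}

/-- If `supp x ⊆ [0, c)` and `2c ≤ n`, the shifted exponent `shift x = x ∘ (· - c)` is supported in
`[c, n)` (no wrap-around in `Fin n`). [folklore] -/
theorem le_of_mem_support_mapDomain (hc : 2 * (c : ℕ) ≤ n) {x : Fin n →₀ ℕ}
    (hx : ∀ i ∈ x.support, (i : ℕ) < c) {j : Fin n}
    (hj : j ∈ (x.mapDomain (· + c)).support) : (c : ℕ) ≤ j := by
  classical
  obtain ⟨i, hi, rfl⟩ := Finset.mem_image.mp (Finsupp.mapDomain_support hj)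
  have hi' : (i : ℕ) + (c : ℕ) < n := by have := hx i hi; omega
  show (c : ℕ) ≤ ((i + c : Fin n) : ℕ)
  rw [Fin.val_add_eq_of_add_lt hi']
  exact Nat.le_add_left _ _

/-- If `supp x ⊆ [0, c)` and `2c ≤ n`, then `shift x` vanishes on `[0, c)`. [folklore] -/
theorem mapDomain_apply_of_lt (hc : 2 * (c : ℕ) ≤ n) {x : Fin n →₀ ℕ}
    (hx : ∀ i ∈ x.support, (i : ℕ) < c) {j : Fin n} (hj : (j : ℕ) < c) :
    x.mapDomain (· + c) j = 0 := by
  by_contra h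
  have := le_of_mem_support_mapDomain hc hx (Finsupp.mem_support_iff.mpr h)
  omega

/-- Balanced exponents determine their halves: if `p + shift p₀ = x + shift x` with `p, p₀, x`
all supported in `[0, c)` (`2c ≤ n`), then `p = x` (compare coordinates `< c`) and `p₀ = x`
(cancel, `shift` is injective). [folklore] -/
theorem eq_of_add_mapDomain_eq (hc : 2 * (c : ℕ) ≤ n) {p p₀ x : Fin n →₀ ℕ}
    (hp : ∀ i ∈ p.support, (i : ℕ) < c) (hp₀ : ∀ i ∈ p₀.support, (i : ℕ) < c)
    (hx : ∀ i ∈ x.support, (i : ℕ) < c)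
    (h : p + p₀.mapDomain (· + c) = x + x.mapDomain (· + c)) : p = x ∧ p₀ = x := by
  have hpx : p = x := by
    ext j
    have hj := DFunLike.congr_fun h j
    rw [Finsupp.add_apply, Finsupp.add_apply] at hj
    by_cases hjc : (j : ℕ) < c
    · rwa [mapDomain_apply_of_lt hc hp₀ hjc, mapDomain_apply_of_lt hc hx hjc, add_zero,
        add_zero] at hj
    · rw [Finsupp.notMem_support_iff.mp fun hm => hjc (hp j hm),
        Finsupp.notMem_support_iff.mp fun hm => hjc (hx j hm)]
  subst hpx
  exact ⟨rfl, Finsupp.mapDomain_injective (add_left_injective c) (add_left_cancel h)⟩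

end Shift

section Support

variable {R : Type*} [CommSemiring R] {n : ℕ} {c : Fin n} {S : MvPolynomial (Fin n) R}
  (hS : S = ∑ i ∈ Finset.univ.filter (fun i : Fin n => (i : ℕ) < c), X i * X (i + c))
include hS

/-- Every monomial of `S^d`, `S = Σ_{i < c} x_i x_{i+c}`, is balanced: `x + shift x` with
`supp x ⊆ [0, c)` and `|x| = d` (induction on `d`; `supp (A B) ⊆ supp A + supp B`). [folklore] -/
theorem exists_of_mem_support_pow :
    ∀ (d : ℕ) (m : Fin n →₀ ℕ), m ∈ (S ^ d).support →
      ∃ x : Fin n →₀ ℕ, (∀ i ∈ x.support, (i : ℕ) < c) ∧ x.degree = d ∧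
        m = x + x.mapDomain (· + c) := by
  classical
  intro d
  induction d with
  | zero =>
    intro m hm
    rw [pow_zero, one_def] at hm
    have hm0 : m = 0 := Finset.mem_singleton.mp (support_monomial_subset hm)
    refine ⟨0, fun i hi => ?_, map_zero _, ?_⟩
    · simp at hi
    · rw [hm0, Finsupp.mapDomain_zero, add_zero]
  | succ d ih =>
    intro m hm
    rw [pow_succ] at hm
    obtain ⟨m₁, hm₁, m₂, hm₂, rfl⟩ := Finset.mem_add.mp (support_mul _ _ hm)
    obtain ⟨x, hx, hxd, rfl⟩ := ih m₁ hm₁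
    rw [hS] at hm₂
    obtain ⟨i, hi, hm₂i⟩ := Finset.mem_biUnion.mp (support_sum hm₂)
    have hic : (i : ℕ) < c := (Finset.mem_filter.mp hi).2
    have hXX : (X i * X (i + c) : MvPolynomial (Fin n) R) =
        monomial (Finsupp.single i 1 + Finsupp.single (i + c) 1) 1 := by
      rw [monomial_single_add, ← X_pow_eq_monomial, pow_one, pow_one]
    rw [hXX] at hm₂i
    have hm₂ : m₂ = Finsupp.single i 1 + Finsupp.single (i + c) 1 :=
      Finset.mem_singleton.mp (support_monomial_subset hm₂i)
    refine ⟨x + Finsupp.single i 1, ?_, ?_, ?_⟩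
    · intro j hj
      rcases Finset.mem_union.mp (Finsupp.support_add hj) with h | h
      · exact hx j h
      · rw [Finset.mem_singleton.mp (Finsupp.support_single_subset h)]
        exact hic
    · rw [map_add, hxd, Finsupp.degree_single]
    · rw [hm₂, Finsupp.mapDomain_add, Finsupp.mapDomain_single]
      exact add_add_add_comm _ _ _ _

end Support

section NatCoeff

variable {n : ℕ} {c : Fin n} {S : MvPolynomial (Fin n) ℕ}
  (hS : S = ∑ i ∈ Finset.univ.filter (fun i : Fin n => (i : ℕ) < c), X i * X (i + c))
include hS

/-- Over `ℕ`, `coeff_{e_i + e_{i+c}} S ≥ 1` for `i < c` (the `i`-th summand of `S` contributes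
`coeff_{e_i} x_i · coeff_{e_{i+c}} x_{i+c} = 1`, the others are `≥ 0`). [folklore] -/
theorem one_le_coeff_pairing {i : Fin n} (hi : (i : ℕ) < c) :
    1 ≤ coeff (Finsupp.single i 1 + Finsupp.single (i + c) 1) S := by
  classical
  rw [hS, coeff_sum]
  have hiL : i ∈ Finset.univ.filter (fun j : Fin n => (j : ℕ) < c) :=
    Finset.mem_filter.mpr ⟨Finset.mem_univ _, hi⟩
  calc 1 = coeff (Finsupp.single i 1) (X i : MvPolynomial (Fin n) ℕ) *
        coeff (Finsupp.single (i + c) 1) (X (i + c) : MvPolynomial (Fin n) ℕ) := by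
        rw [coeff_X_same, coeff_X_same, mul_one]
    _ ≤ coeff (Finsupp.single i 1 + Finsupp.single (i + c) 1)
          (X i * X (i + c) : MvPolynomial (Fin n) ℕ) := mul_coeff_le_coeff_mul _ _ _ _
    _ ≤ ∑ j ∈ Finset.univ.filter (fun j : Fin n => (j : ℕ) < c),
          coeff (Finsupp.single i 1 + Finsupp.single (i + c) 1)
            (X j * X (j + c) : MvPolynomial (Fin n) ℕ) :=
        Finset.single_le_sum (f := fun j => coeff (Finsupp.single i 1 + Finsupp.single (i + c) 1)
          (X j * X (j + c) : MvPolynomial (Fin n) ℕ)) (fun _ _ => Nat.zero_le _) hiL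

/-- Over `ℕ`, the diagonal entry is positive: `coeff_{x + shift x} S^{|x|} ≥ 1` for
`supp x ⊆ [0, c)` (induction on `|x|`, peeling one factor `x_i x_{i+c}` with `x_i ≥ 1` and using
`coeff_{a+b}(A B) ≥ coeff_a A · coeff_b B`). [folklore] -/
theorem one_le_coeff_pairing_pow :
    ∀ (d : ℕ) (x : Fin n →₀ ℕ), (∀ i ∈ x.support, (i : ℕ) < c) → x.degree = d →
      1 ≤ coeff (x + x.mapDomain (· + c)) (S ^ d) := by
  classical
  intro d
  induction d with
  | zero =>
    intro x _ hd
    have hx0 : x = 0 := (Finsupp.degree_eq_zero_iff x).mp hd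
    subst hx0
    rw [Finsupp.mapDomain_zero, add_zero, pow_zero, coeff_zero_one]
  | succ d ih =>
    intro x hx hd
    have hx0 : x ≠ 0 := by
      rintro rfl
      rw [map_zero] at hd
      omega
    obtain ⟨i, hi⟩ : x.support.Nonempty := Finsupp.support_nonempty_iff.mpr hx0
    have hic : (i : ℕ) < c := hx i hi
    have hle : Finsupp.single i 1 ≤ x :=
      Finsupp.single_le_iff.mpr (Nat.one_le_iff_ne_zero.mpr (Finsupp.mem_support_iff.mp hi))
    obtain ⟨x', rfl⟩ : ∃ x', x = x' + Finsupp.single i 1 :=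
      ⟨x - Finsupp.single i 1, (tsub_add_cancel_of_le hle).symm⟩
    have hd' : x'.degree = d := by
      rw [map_add, Finsupp.degree_single] at hd
      omega
    have hx' : ∀ j ∈ x'.support, (j : ℕ) < c := fun j hj =>
      hx j (Finsupp.mem_support_iff.mpr (by
        rw [Finsupp.add_apply]
        have := Finsupp.mem_support_iff.mp hj
        omega))
    rw [Finsupp.mapDomain_add, Finsupp.mapDomain_single, add_add_add_comm, pow_succ]
    calc 1 = 1 * 1 := (mul_one 1).symm
      _ ≤ coeff (x' + x'.mapDomain (· + c)) (S ^ d) *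
            coeff (Finsupp.single i 1 + Finsupp.single (i + c) 1) S :=
          Nat.mul_le_mul (ih x' hx' hd') (one_le_coeff_pairing hS hic)
      _ ≤ _ := mul_coeff_le_coeff_mul _ _ _ _

end NatCoeff

section ComplexWitness

variable {n : ℕ} {c : Fin n} {S : MvPolynomial (Fin n) ℂ}
  (hS : S = ∑ i ∈ Finset.univ.filter (fun i : Fin n => (i : ℕ) < c), X i * X (i + c))
include hS

/-- `S` over `ℂ` is the image of the same inner product over `ℕ`. [folklore] -/
theorem map_pairing :
    MvPolynomial.map (Nat.castRingHom ℂ)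
        (∑ i ∈ Finset.univ.filter (fun i : Fin n => (i : ℕ) < c), X i * X (i + c) :
          MvPolynomial (Fin n) ℕ) = S := by
  rw [hS, map_sum]
  simp_rw [map_mul, map_X]

/-- Over `ℂ`, the diagonal entry `coeff_{x + shift x} S^{|x|}` is nonzero (a positive integer in
characteristic zero) for `supp x ⊆ [0, c)`. [folklore] -/
theorem coeff_pairing_pow_ne_zero (x : Fin n →₀ ℕ) (hx : ∀ i ∈ x.support, (i : ℕ) < c) :
    coeff (x + x.mapDomain (· + c)) (S ^ x.degree) ≠ 0 := by
  rw [← map_pairing hS, ← map_pow, coeff_map, eq_natCast, Nat.cast_ne_zero]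
  exact Nat.one_le_iff_ne_zero.mp (one_le_coeff_pairing_pow rfl _ x hx rfl)

/-- `deg S ≤ 2`. [folklore] -/
theorem totalDegree_pairing_le : S.totalDegree ≤ 2 := by
  rw [hS]
  refine totalDegree_finsetSum_le fun i _ => (totalDegree_mul _ _).trans ?_
  rw [totalDegree_X, totalDegree_X]

/-- `deg (Σ_{j ≤ k} S^j) ≤ 2k`. [folklore] -/
theorem totalDegree_witness_le (k : ℕ) :
    (∑ j ∈ Finset.range (k + 1), S ^ j).totalDegree ≤ 2 * k := by
  refine totalDegree_finsetSum_le fun j hj => (totalDegree_pow _ _).trans ?_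
  have hjk : j ≤ k := Nat.lt_succ_iff.mp (Finset.mem_range.mp hj)
  calc j * S.totalDegree ≤ k * 2 := Nat.mul_le_mul hjk (totalDegree_pairing_le hS)
    _ = 2 * k := mul_comm _ _

/-- `L(S) ≤ 2c`: one product gate per summand `x_i x_{i+c}` (variables are free) and `c` addition
gates. [cite: Burgisser2000, §2.1] -/
theorem complexity_pairing_le : complexity S ≤ 2 * (c : ℕ) := by
  have hX : ∀ i : Fin n, complexity (X i : MvPolynomial (Fin n) ℂ) = 0 := complexity_X_holds
  have hterm : ∀ i : Fin n, complexity (X i * X (i + c) : MvPolynomial (Fin n) ℂ) ≤ 1 := fun i =>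
    (complexity_mul_le_holds _ _).trans (by simp [hX])
  have hcard : (Finset.univ.filter (fun i : Fin n => (i : ℕ) < c)).card ≤ c := by
    rw [Fin.card_filter_val_lt]
    exact min_le_right _ _
  rw [hS]
  calc complexity (∑ i ∈ Finset.univ.filter (fun i : Fin n => (i : ℕ) < c),
          (X i * X (i + c) : MvPolynomial (Fin n) ℂ))
      ≤ ∑ i ∈ Finset.univ.filter (fun i : Fin n => (i : ℕ) < c),
            complexity (X i * X (i + c) : MvPolynomial (Fin n) ℂ) +
          (Finset.univ.filter (fun i : Fin n => (i : ℕ) < c)).card := complexity_finset_sum_le _ _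
    _ ≤ ∑ i ∈ Finset.univ.filter (fun i : Fin n => (i : ℕ) < c), 1 +
          (Finset.univ.filter (fun i : Fin n => (i : ℕ) < c)).card :=
        Nat.add_le_add_right (Finset.sum_le_sum fun i _ => hterm i) _
    _ ≤ 2 * (c : ℕ) := by
        rw [Finset.sum_const, smul_eq_mul, mul_one]
        omega

/-- `L(Σ_{j ≤ k} S^j) ≤ k (2c + 2)` (Horner). [cite: Burgisser2000, §2.1] -/
theorem complexity_witness_le (k : ℕ) :
    complexity (∑ j ∈ Finset.range (k + 1), S ^ j) ≤ k * (2 * (c : ℕ) + 2) :=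
  (complexity_geom_sum_le S k).trans
    (Nat.mul_le_mul_left k (Nat.add_le_add_right (complexity_pairing_le hS) 2))

/-- Off-diagonal vanishing: for rows `p ≠ p₀` (both supported in `[0, c)`, `2c ≤ n`) the entry of
`f = Σ_{j ≤ k} S^j` at column `shift p₀` is `coeff_{p + shift p₀} f = 0`, since a monomial of `f`
is balanced. [folklore] -/
theorem coeff_witness_eq_zero (hc : 2 * (c : ℕ) ≤ n) (k : ℕ) {p p₀ : Fin n →₀ ℕ}
    (hp : ∀ i ∈ p.support, (i : ℕ) < c) (hp₀ : ∀ i ∈ p₀.support, (i : ℕ) < c) (hne : p ≠ p₀) :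
    coeff (p + p₀.mapDomain (· + c)) (∑ j ∈ Finset.range (k + 1), S ^ j) = 0 := by
  classical
  by_contra h0
  rw [coeff_sum] at h0
  obtain ⟨j, -, hj⟩ := Finset.exists_ne_zero_of_sum_ne_zero h0
  obtain ⟨x, hx, -, hxeq⟩ :=
    exists_of_mem_support_pow hS j _ (MvPolynomial.mem_support_iff.mpr hj)
  obtain ⟨rfl, rfl⟩ := eq_of_add_mapDomain_eq hc hp hp₀ hx hxeq
  exact hne rfl

/-- Diagonal non-vanishing: for a row `p₀` (supported in `[0, c)`, `|p₀| ≤ k`, `2c ≤ n`) the entry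
of `f = Σ_{j ≤ k} S^j` at column `shift p₀` is `coeff_{p₀ + shift p₀} S^{|p₀|} ≠ 0` (only the
summand `j = |p₀|` contributes). [folklore] -/
theorem coeff_witness_ne_zero (hc : 2 * (c : ℕ) ≤ n) {k : ℕ} {p₀ : Fin n →₀ ℕ}
    (hp₀ : ∀ i ∈ p₀.support, (i : ℕ) < c) (hdeg : p₀.degree ≤ k) :
    coeff (p₀ + p₀.mapDomain (· + c)) (∑ j ∈ Finset.range (k + 1), S ^ j) ≠ 0 := by
  classical
  rw [coeff_sum, Finset.sum_eq_single p₀.degree]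
  · exact coeff_pairing_pow_ne_zero hS p₀ hp₀
  · intro j _ hj
    by_contra h0
    obtain ⟨x, hx, hxd, hxeq⟩ :=
      exists_of_mem_support_pow hS j _ (MvPolynomial.mem_support_iff.mpr h0)
    obtain ⟨-, rfl⟩ := eq_of_add_mapDomain_eq hc hp₀ hp₀ hx hxeq
    exact hj hxd.symm
  · intro h
    exact absurd (Finset.mem_range.mpr (Nat.lt_succ_of_le hdeg)) h

end ComplexWitness

end PartitionRankMaximal

open PartitionRankMaximal

/-- **Registered stub `stub_partitionRankMaximal`** (crux stmt-ValiantsHypothesis-14610, line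
`registered`; the coefficient matrix of a variable partition — Nisan 1991 / Raz 2009, evaluation
dimension — is maximal on small circuits over `ℂ`): for `n ≥ 2`, `2h ≤ n`, `2k ≤ n` some
`f ∈ SmallCircuits ℂ n 2` has a partition coefficient matrix `M[p, q] = coeff_{p+q} f` — rows:
monomials `p` in the first `h` variables of degree `≤ k`; columns: monomials `q` in the remaining
variables of degree `≤ n - k` — with linearly independent rows. Witness:
`f = Σ_{d ≤ k} (Σ_{i < h} x_i x_{h+i})^d` (size `≤ k (2h + 2) ≤ n²`, degree `≤ 2k ≤ n`); on the
columns `q = shift p₀` the matrix is diagonal with nonzero diagonal.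
(Framework: Forbes–Shpilka–Volk 2018, Question 6 / Cor. 5.) [cite: Raz2009, §1] -/
theorem stub_partitionRankMaximal :
    ∀ n h k : ℕ, 2 ≤ n → 2 * h ≤ n → 2 * k ≤ n → ∃ f ∈ SmallCircuits ℂ n 2,
      LinearIndependent ℂ
        (fun p : {p : Fin n →₀ ℕ // (∀ i ∈ p.support, (i : ℕ) < h) ∧ p.degree ≤ k} =>
          fun q : {q : Fin n →₀ ℕ // (∀ i ∈ q.support, h ≤ (i : ℕ)) ∧ q.degree ≤ n - k} =>
            MvPolynomial.coeff (p.1 + q.1) f) := by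
  intro n h k hn hh hk
  obtain ⟨c, rfl⟩ : ∃ c : Fin n, (c : ℕ) = h := ⟨⟨h, by omega⟩, rfl⟩
  set S : MvPolynomial (Fin n) ℂ :=
    ∑ i ∈ Finset.univ.filter (fun i : Fin n => (i : ℕ) < c), X i * X (i + c) with hS
  refine ⟨∑ j ∈ Finset.range (k + 1), S ^ j,
    ⟨(totalDegree_witness_le hS k).trans hk, (complexity_witness_le hS k).trans ?_⟩, ?_⟩
  · -- `k (2c + 2) ≤ n²` from `2k ≤ n`, `2c ≤ n`, `2 ≤ n`
    have key : 2 * (k * (2 * (c : ℕ) + 2)) ≤ 2 * n ^ 2 :=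
      calc 2 * (k * (2 * (c : ℕ) + 2)) = (2 * k) * (2 * (c : ℕ) + 2) := by ring
        _ ≤ n * (2 * (c : ℕ) + 2) := Nat.mul_le_mul_right _ hk
        _ ≤ n * (n + n) := Nat.mul_le_mul_left _ (by omega)
        _ = 2 * n ^ 2 := by ring
    omega
  · rw [linearIndependent_iff']
    intro s g hg p₀ hp₀
    have hq₀ : (∀ i ∈ (p₀.1.mapDomain (· + c)).support, (c : ℕ) ≤ (i : ℕ)) ∧
        (p₀.1.mapDomain (· + c)).degree ≤ n - k :=
      ⟨fun i hi => le_of_mem_support_mapDomain hh p₀.2.1 hi, by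
        rw [Finsupp.degree_mapDomain]
        have := p₀.2.2
        omega⟩
    have key := congr_fun hg ⟨p₀.1.mapDomain (· + c), hq₀⟩
    simp only [Finset.sum_apply, Pi.smul_apply, smul_eq_mul, Pi.zero_apply] at key
    rw [Finset.sum_eq_single p₀ (fun p _ hne => by
        rw [coeff_witness_eq_zero hS hh k p.2.1 p₀.2.1 (fun h => hne (Subtype.ext h)),
          mul_zero]) (fun h => (h hp₀).elim)] at key
    exact (mul_eq_zero.mp key).resolve_right (coeff_witness_ne_zero hS hh p₀.2.1 p₀.2.2)

end Summit.ValiantsHypothesis.ValiantsHypothesis.Theorems.BarrierLever.SuccinctHittingSetsForVP
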